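/-
Copyright (c) 2026 the pub-hodgecm-mathlib formalisation cell (harness21).  Prover seat hodgecm-mathlib-K2E1-p08 (g4), Track B ∕ K2-LIT, h413 =
`stmt-HodgeConjecture-24833`, line `K2_E1_TraceFormulaBeta`, campaign «RES-RANK-ONE»; DEAL «EISENSTEIN-SIDE ENTRANCE: height» of the dealer K2E1-plan (g2) 2026-09-04T03:53:43Z,
re-scoped 03:59:41Z (U(Φ₃) native) and ruled 04:01:46Z (CITE ★ `UnitaryGroupBorelHeight`, type the thin bridge only, Mok currency): the three missing height facts.
-/
import Summits.HodgeConjecture.HodgeConjecture.Theorems.K2E1HeisenbergRadicalConjugationU3   -- ★ p856xxx (K2E1-p09 g2) + p855820: the ray `a(r)`, `exists_torusInBorel_ray`, `glDiagonal_ray_mem_adelic`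
import Literature.NumberTheory.Automorphic.UnitaryGroupBorelHeight                            -- ★ `borelHeight`, `borelHeight_torus_mul'`, `lastRow`
import Literature.NumberTheory.Automorphic.UnitaryGroupBorelModulusThree                      -- ★ `modularCharacter_borelAdelic_torus`, `torusRootModulus_three_eq`
import Literature.NumberTheory.Automorphic.IdeleClassGroupProofs                              -- ★ `ideleNorm_posRealIdele_holds` (`‖z(r)‖_𝔸 = r^{[E:ℚ]}`)
import HarnessLib

/-!
# K2·E1 — `K2E1HeightFunctionU3`: THE BOREL HEIGHT OF `U(Φ₃)` — the `δ_B^{1/2}` link, the ray normalisation, `H(1) = 1`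
# (campaign «RES-RANK-ONE», Eisenstein-side entrance; a thin bridge over ★ `UnitaryGroupBorelHeight`)

Track B ∕ K2-LIT, crux h413 = `stmt-HodgeConjecture-24833`, route of record `HCCMUnconditional`; cell `hodgecm-mathlib`, squad K2, ENGINE E1.  Prover seat `hodgecm-mathlib-K2E1-p08`
(g4); DEAL of the dealer K2E1-plan (g2) 2026-09-04T03:53:43Z ∕ 03:59:41Z ∕ RULING 04:01:46Z: «the height stack for every `N` IS ★ `UnitaryGroupBorelHeight` ∕ `…Continuous` ∕ `…BigCell` ∕
`…SiegelSet*` ∕ `…Truncation` ∕ `…BorelInduction` (same ★ `vecHeight` as K2Liu) — NO new def; type only (i) the `δ_B` link in `modularCharacter` currency, (ii) the ray normalisation,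
(iii) `borelHeight 1 = 1`; the whole Eisenstein side is typed over MOK's `quasiSplit L⁺ L c N = cmDatum L N J_N`, the literal-`Φ_N` sockets being reached only at the last line by ★
`StdForm.over_antidiagonal_eq`».  THEOREMS ONLY (no `def`, no `instance`, no notation, no named-fact hypothesis, no `sorry`); lane `--supports stmt-HodgeConjecture-24833 --as helper`
(count-neutral).  Closes no socket.

THE HEIGHT (★, cited not restated).  On Mok's `U(J_N)(𝔸_F)` (`quasiSplit F E c N`), ★ `borelHeight g = (vecHeight E (e_N · g))⁻¹ ∈ ℝ≥0` [Garrett2018 §2.2; Godement1964 §1] with: left-`N(𝔸)`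
★ `borelHeight_unipotent_mul`; torus law ★ `borelHeight_torus_mul'` (`H(t g) = ‖d₀‖_{𝔸_E} · H(g)`); rational Borel ★ `borelHeight_rational_borel_mul`; right-`K` ★
`borelHeight_mul_of_forall_vecHeight_vecMul_eq` ∕ `borelHeight_mul_of_mem_comap_standardMaximalCompactGL`; continuity ★ `continuous_borelHeight`; big cell (`N = 3`) ★
`borelHeight_mul_borelHeight_le_one_of_not_mem_borelAdelic`.  So `borelHeight = e^{H_B}` is Arthur's ∕ Rogawski's `δ_B^{1/2}`-height [Rogawski1990, §2.2: `H(a m n k) = log a`], the function the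
Borel Eisenstein series `E(φ, s)(g) = Σ_{γ ∈ B(F)∖G(F)} φ(γg) H(γg)^{s + 1}` of `U(Φ₃)` is built on.

WHAT (this file, `N = 3`, generic quadratic `E/F` with involution `c`; the CM pair `F = L⁺, E = L` is an instance).
* §1 (iii) `lastRow_one`, **`borelHeight_one`**: `H(1) = 1` (`e_N · 1 = e_N`, ★ `vecHeight_single`, `‖1‖_𝔸 = 1`) — every `N`.
* §2 (i) THE `δ_B^{1/2}` LINK: **`borelHeight_torus_mul_sq`** — for `t = diag(d) ∈ T(𝔸_F)` of `U(J₃)`, `H(t g)² = δ_B(t) · H(g)²` with `δ_B = ` ★ `torusRootModulus E 3 d = ‖d₀‖²`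
  (★ `torusRootModulus_three_eq`, ★ Tate `AdeleRing.distribHaarChar_eq_ideleNorm`); **`borelHeight_torus_mul_sq_modularCharacter`** — the same with Mathlib's `modularCharacter` of `B(𝔸_F)`
  (★ `modularCharacter_borelAdelic_torus`, `c² = 1`, `c ≠ 1`).  I.e. `H(mg) = δ_B(m)^{1/2} H(g)` on the Levi [Rogawski1990, §2.2; MoeglinWaldspurger1995, I.2.1].
* §3 (ii) RAY NORMALISATION: for any `a(r) ∈ U(J₃)(𝔸_F)` with matrix `diag(z(r), 1, z(r)⁻¹)` (`z(r)` = ★ `posRealIdele E r`; `exists_ray` from ★ p855820 `glDiagonal_ray_mem_adelic`), **`borelHeight_ray_mul`**: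
  `H(a(r) g) = r^{[E:ℚ]} · H(g)` (★ `borelHeight_torus_mul'` + ★ `ideleNorm_posRealIdele_holds`) and **`borelHeight_ray`**: `H(a(r)) = r^{[E:ℚ]}` — the normalisation against which the
  exponents `s` of the constant terms along the ray are read ((H4-b)'s `T`).
HONEST LABEL: HC_CM is proved only modulo the 7 printed citations (2 remaining named inputs: hLiu418 = `stmt-HodgeConjecture-24832`, h413 = `stmt-HodgeConjecture-24833`) until rung 0
closes; this file asserts no named fact and closes no socket.
References: [Rogawski1990] J. D. Rogawski, *Automorphic Representations of Unitary Groups in Three Variables* (1990), §2.2 p. 13 · [MoeglinWaldspurger1995] I.2.1 · [Garrett2018] P. Garrett,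
*Modern Analysis of Automorphic Forms by Example* (2018), §2.2 · [Godement1964] Sém. Bourbaki 257, §1 · [WeilBNT1967] A. Weil, *Basic Number Theory*, Ch. IV §4.
-/

set_option autoImplicit false
-- the mandated namespace repeats the single-problem summit's segment (`HodgeConjecture.HodgeConjecture`)
set_option linter.dupNamespace false

noncomputable section

open MeasureTheory Measure NumberField IsDedekindDomain Matrix
open scoped NNReal MatrixGroups
open Literature.NumberTheory.Automorphic Literature.NumberTheory.Automorphic.UnitaryGroup
open Summit.HodgeConjecture.HodgeConjecture.Cruxes.H413.K2E1ReductionTheoryU3 (glDiagonal_ray_mem_adelic)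
open Summit.HodgeConjecture.HodgeConjecture.Cruxes.H413.K2E1HeisenbergRadicalConjugationU3 (exists_torusInBorel_ray)

namespace Summit.HodgeConjecture.HodgeConjecture.Cruxes.H413.K2E1HeightFunctionU3

variable {F E : Type} [Field F] [NumberField F] [Field E] [NumberField E] [Algebra F E] {c : E ≃ₐ[F] E}

/-! ## §1 `H(1) = 1` -/

section One

variable {N : ℕ} [NeZero N]

/-- The last row of the identity is `e_N`. [folklore] -/
theorem lastRow_one : lastRow (1 : (quasiSplit F E c N).Adelic) = Pi.single (⊤ : Fin N) (1 : AdeleRing (𝓞 E) E) := by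
  funext j
  rw [lastRow_apply, map_one, Units.val_one, Matrix.one_eq_pi_single]

/-- **`H(1) = 1`**: the Borel height of the identity (`h(e_N) = ‖1‖_𝔸 = 1`, ★ `vecHeight_single`). [cite: Garrett2018, §2.2] -/
theorem borelHeight_one : borelHeight (1 : (quasiSplit F E c N).Adelic) = 1 := by
  rw [borelHeight_def, lastRow_one, show (1 : AdeleRing (𝓞 E) E) = ((1 : (AdeleRing (𝓞 E) E)ˣ) : AdeleRing (𝓞 E) E) from rfl,
    vecHeight_single, map_one, inv_one]

end One

/-! ## §2 The `δ_B^{1/2}` link on the torus of `U(J₃)` -/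

/-- **`H(t g)² = δ_B(t) · H(g)²` in ★ `torusRootModulus` currency**: for `t = diag(d) ∈ T(𝔸_F) ≤ U(J₃)(𝔸_F)`, `borelHeight (t g)² = torusRootModulus E 3 d · borelHeight g²` — the Borel height is
the `δ_B^{1/2}`-height (★ `borelHeight_torus_mul'`: factor `‖d₀‖`; ★ `torusRootModulus_three_eq` + Tate ★ `AdeleRing.distribHaarChar_eq_ideleNorm`: `δ_B(diag d) = ‖d₀‖²`).
[cite: Rogawski1990, §2.2] [cite: MoeglinWaldspurger1995, I.2.1] -/
theorem borelHeight_torus_mul_sq (t : torusInBorel F E c 3) {d : Fin 3 → (AdeleRing (𝓞 E) E)ˣ}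
    (hd : glDiagonal 3 (AdeleRing (𝓞 E) E) d = adelicVal F E c 3 _ ((t : borelAdelic F E c 3) : (quasiSplit F E c 3).Adelic)) (g : (quasiSplit F E c 3).Adelic) :
    borelHeight (((t : borelAdelic F E c 3) : (quasiSplit F E c 3).Adelic) * g) * borelHeight (((t : borelAdelic F E c 3) : (quasiSplit F E c 3).Adelic) * g) =
      torusRootModulus E 3 d * (borelHeight g * borelHeight g) := by
  haveI := locallyCompactSpace_adeleRing' E
  rw [borelHeight_torus_mul' hd g, torusRootModulus_three_eq t hd, AdeleRing.distribHaarChar_eq_ideleNorm]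
  ring

/-- **`H(t g)² = Δ_B(t) · H(g)²` in Mathlib's `modularCharacter` currency** (`c² = 1`, `c ≠ 1`; ★ `modularCharacter_borelAdelic_torus`: `Δ_B(diag d) = torusRootModulus E 3 d` for the locally compact group
`B(𝔸_F)`).  I.e. on the Levi `H(m g) = δ_B(m)^{1/2} H(g)`, the normalisation of the induced representation `i_B(χ) = Ind(χ δ_B^{1/2})` and of the Eisenstein exponent `s + ρ`, `ρ = 1`.
[cite: Rogawski1990, §2.2] [cite: MoeglinWaldspurger1995, I.2.1] -/
theorem borelHeight_torus_mul_sq_modularCharacter (hc : c * c = 1) (hc1 : c ≠ 1) (t : torusInBorel F E c 3) {d : Fin 3 → (AdeleRing (𝓞 E) E)ˣ}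
    (hd : glDiagonal 3 (AdeleRing (𝓞 E) E) d = adelicVal F E c 3 _ ((t : borelAdelic F E c 3) : (quasiSplit F E c 3).Adelic)) (g : (quasiSplit F E c 3).Adelic) :
    borelHeight (((t : borelAdelic F E c 3) : (quasiSplit F E c 3).Adelic) * g) * borelHeight (((t : borelAdelic F E c 3) : (quasiSplit F E c 3).Adelic) * g) =
      (haveI := locallyCompactSpace_borelAdelic (F := F) (E := E) (c := c) (N := 3);
        modularCharacter ((t : borelAdelic F E c 3)) : ℝ≥0) * (borelHeight g * borelHeight g) := by
  rw [modularCharacter_borelAdelic_torus hc hc1 t hd]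
  exact borelHeight_torus_mul_sq t hd g

/-! ## §3 The archimedean ray `a(r) = diag(z(r), 1, z(r)⁻¹)` -/

/-- **RAY NORMALISATION**: `H(a(r) g) = r^{[E:ℚ]} · H(g)` for any `a(r) ∈ U(J₃)(𝔸_F)` with matrix `diag(z(r), 1, z(r)⁻¹)` (it exists: ★ p855820 `glDiagonal_ray_mem_adelic`; it is a torus element: ★
`exists_torusInBorel_ray`), since `H(t g) = ‖d₀‖ H(g)` (★ `borelHeight_torus_mul'`) and `‖z(r)‖_{𝔸_E} = r^{[E:ℚ]}` (★ `ideleNorm_posRealIdele_holds`). [cite: Rogawski1990, §2.2] [cite: WeilBNT1967, Ch. IV §4] -/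
theorem borelHeight_ray_mul (r : ℝ≥0ˣ) {a : (quasiSplit F E c 3).Adelic}
    (ha : glDiagonal 3 (AdeleRing (𝓞 E) E) ![posRealIdele E r, 1, posRealIdele E r⁻¹] = adelicVal F E c 3 _ a) (g : (quasiSplit F E c 3).Adelic) :
    borelHeight (a * g) = (r : ℝ≥0) ^ Module.finrank ℚ E * borelHeight g := by
  rw [borelHeight_torus_mul' (d := ![posRealIdele E r, 1, posRealIdele E r⁻¹]) ha g]
  congr 1
  exact ideleNorm_posRealIdele_holds E r

/-- **`H(a(r)) = r^{[E:ℚ]}`** — the height of the ray element itself (§3 at `g = 1` with §1 `borelHeight_one`): the scale on which the exponents of the constant terms along the ray are read.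
[cite: Rogawski1990, §2.2] -/
theorem borelHeight_ray (r : ℝ≥0ˣ) {a : (quasiSplit F E c 3).Adelic}
    (ha : glDiagonal 3 (AdeleRing (𝓞 E) E) ![posRealIdele E r, 1, posRealIdele E r⁻¹] = adelicVal F E c 3 _ a) :
    borelHeight a = (r : ℝ≥0) ^ Module.finrank ℚ E := by
  have h := borelHeight_ray_mul r ha 1
  rwa [mul_one, borelHeight_one, mul_one] at h

/-- A ray element EXISTS in `U(J₃)(𝔸_F)` (★ p855820 `glDiagonal_ray_mem_adelic`, restated as an `∃` over the datum's carrier for the consumers of §3). [cite: Rogawski1990, §1.10 p. 9] -/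
theorem exists_ray (r : ℝ≥0ˣ) :
    ∃ a : (quasiSplit F E c 3).Adelic, glDiagonal 3 (AdeleRing (𝓞 E) E) ![posRealIdele E r, 1, posRealIdele E r⁻¹] = adelicVal F E c 3 _ a :=
  ⟨⟨glDiagonal 3 (AdeleRing (𝓞 E) E) ![posRealIdele E r, 1, posRealIdele E r⁻¹], glDiagonal_ray_mem_adelic (F := F) (c := c) r⟩, rfl⟩

/-- Along the ray the squared height scales by `δ_B(a(r)) = r^{2[E:ℚ]}`: `H(a(r) g)² = (r^{[E:ℚ]})² · H(g)²` (§3; consistent with §2, `a(r)` being a torus element ★ `exists_torusInBorel_ray`).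
[cite: Rogawski1990, §2.2] -/
theorem borelHeight_ray_mul_sq (r : ℝ≥0ˣ) {a : (quasiSplit F E c 3).Adelic}
    (ha : glDiagonal 3 (AdeleRing (𝓞 E) E) ![posRealIdele E r, 1, posRealIdele E r⁻¹] = adelicVal F E c 3 _ a) (g : (quasiSplit F E c 3).Adelic) :
    borelHeight (a * g) ^ 2 = ((r : ℝ≥0) ^ Module.finrank ℚ E) ^ 2 * borelHeight g ^ 2 := by
  rw [borelHeight_ray_mul r ha, mul_pow]

end Summit.HodgeConjecture.HodgeConjecture.Cruxes.H413.K2E1HeightFunctionU3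

end
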